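import Summits.MatrixMultiplication.MatrixMultiplication.Theses.GelfandPairHosts

/-!
# Route `GelfandPairHosts` — the assembly item

Item `stmt-MatrixMultiplication-7389` (`Assembly`) of route
`route-MatrixMultiplication-GelfandPairHosts` is the implication
`GelfandHosting → RankFormula → MatrixMultiplication`, which is literally the type of the route's
deciding theorem `closes` (gate-certified, sorry-free, proved in the route file from the tree
theorems `tensorRestrictsTo_precomp`, `TensorRestrictsTo.tensorRank_le`,
`omega_le_three_mul_logb_of_tensorRank_le` (Bläser 2013, Thm 5.9) and `omega_two_le`):
a module-TPP design makes `⟨a,b,c⟩` a coordinate restriction of the action tensor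
`T_{G,X}(y,g,x) = [g • x = y]`, so `R(⟨a,b,c⟩) ≤ R(T_{G,X}) = D(G,X) ≤ (abc)^{(2+ε)/3}`
(`RankFormula`), whence `ω ≤ 2 + ε` for every `ε > 0`.
This file closes the item by applying `closes`.
-/

-- single-conjunct summit: the mandated namespace `Summit.MatrixMultiplication.MatrixMultiplication.…`
-- repeats `MatrixMultiplication` (summit = sub-problem), which `linter.dupNamespace` would flag.
set_option linter.dupNamespace false

namespace Summit.MatrixMultiplication.MatrixMultiplication.Theorems

open Summit.MatrixMultiplication.MatrixMultiplication.Theses.GelfandPairHosts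

/-- The assembly item of route `GelfandPairHosts`: Gelfand hosting (`GelfandHosting`: for every
`ε > 0` a multiplicity-free finite `G`-set with a module-TPP design of size `(a,b,c)`, `abc ≥ 2`,
and host cost `D(G,X) ≤ (abc)^{(2+ε)/3}`) together with the rank formula
(`RankFormula`: `R(T_{G,X}) = D(G,X)` for multiplicity-free `X`) implies `MatrixMultiplication`
(i.e. `ω(ℂ) = 2`). This is exactly the route's deciding theorem `closes`. -/
theorem gelfandPairHosts_assembly_proof :
    Summit.MatrixMultiplication.MatrixMultiplication.Theses.GelfandPairHosts.Assembly := by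
  unfold Summit.MatrixMultiplication.MatrixMultiplication.Theses.GelfandPairHosts.Assembly
  exact fun hX hR => closes hX hR

end Summit.MatrixMultiplication.MatrixMultiplication.Theorems
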